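import Mathlib
import HarnessLib
import Literature.MathematicalPhysics.QuantumFieldTheory.GaussianCovarianceComparisonTrace

/-!
# The log-density of two Hilbert–Schmidt-close centred Gaussians — second-order toolkit
# ([Buc16] Thm 4.5 / [ABKM19] Thm 6.2, preparation of the `ℓ = 2` comparison)

`GaussianCovarianceComparisonTrace.abs_integral_multivariateGaussian_sub_le_of_trace` (the `ℓ = 1`,
dimension-free comparison) writes `dN(0,S₁)/dN(0,S₀) = e^{Z}`, `Z = c + ½Q` with `Q` the centred chaos
`yᵀ(S₀⁻¹ − S₁⁻¹)y − tr(√S₀(S₀⁻¹ − S₁⁻¹)√S₀)` and `−h² ≤ c ≤ 0`, and prices `|e^{Z} − 1| ≤ |Z|e^{|Z|}` in `L^q`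
by `O(qh)`.  The SECOND difference `E_{S₁}H + E_{S₂}H − 2E_{S₀}H` ([Buc16] Thm 4.5 with `ℓ = 2`,
[ABKM19] Thm 6.2 / Lemma 8.4 with `ℓ = 2`) needs one more Taylor order: `e^{Z} − 1 − Z` is priced by
`Z² e^{|Z|}`, whose `L^q` norm is `O(q²h²)`, and the linear terms `Z₁ + Z₂` recombine into ONE centred chaos
(of `2S₀⁻¹ − S₁⁻¹ − S₂⁻¹`) plus the constants.  This file isolates the reusable pieces:

* (`|e^z − 1 − z| ≤ z² e^{|z|}` is the tree's
  `Literature.Analysis.UnboundedOperators.abs_exp_sub_one_sub_le_sq_mul_exp_abs`, used by the consumer);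
* `integral_rpow_sq_mul_exp_abs_le` — from two-sided exponential moments `∫(e^{tZ} + e^{−tZ}) ≤ 2e`
  (`t h ≤ ½`): `∫ (Z² e^{|Z|})^q ≤ (8hq/e)^{2q} · 2e` (`qh ≤ ¼`), the square analogue of
  `integral_rpow_abs_mul_exp_abs_le`;
* `eq_zero_of_trace_mul_sq_le_zero`, `eq_of_trace_mul_inv_sub_sq_le_zero` — the degenerate case
  `tr((S B)²) ≤ 0 ⇒ B = 0` (`B` symmetric, `S ≻ 0`);
* `memLp_quadForm_sub_trace_of_trace` — the centred chaos `Q = yᵀBy − tr(√S B √S)` with `tr((√SB√S)²) ≤ k²`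
  is in `L^q(N(0,S))` with `‖Q‖_{L^q} ≤ 8 q k` (Whittle, `GaussianQuadraticChaosMGF`), `k ≥ 0` allowed;
* `exists_gaussRatio_eq_exp_of_trace` — the representation `dN(0,S₁)/dN(0,S₀)(y) = exp(c + ½Q(y))` with
  `|c| ≤ h²`, for `tr((1 − S₀S₁⁻¹)²) ≤ h²`, `h ≤ ¼` (extracted from the `ℓ = 1` proof).

Everything is proved; no named fact; finite-dimensional Gaussian calculus only.

## References
* S. Buchholz, *Finite range decomposition for Gaussian measures with improved regularity*,
  J. Funct. Anal. 275 (2018), Thm 4.5, Lemma 4.6 [Buchholz2016].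
* S. Adams, S. Buchholz, R. Kotecký, S. Müller, arXiv:1910.13564, Theorem 6.2, Lemma 8.4
  [AdamsBuchholzKoteckyMuller2019].
-/

noncomputable section

namespace Literature.MathematicalPhysics.QuantumFieldTheory

open MeasureTheory ProbabilityTheory Matrix WithLp GaussianToolkit Unitary
open scoped ENNReal NNReal MatrixOrder BigOperators

variable {ι : Type*} [Fintype ι] [DecidableEq ι]

/-! ## The `q`-th moment of `Z² e^{|Z|}` from two-sided exponential moments -/

omit [Fintype ι] [DecidableEq ι] in
/-- **From exponential moments to the `q`-th moment of `Z² e^{|Z|}`** (square analogue of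
`integral_rpow_abs_mul_exp_abs_le`).  If `∫ (e^{tZ} + e^{−tZ}) dμ ≤ 2e` for all `0 ≤ t` with `t·h ≤ ½`
(`0 < h`, `1 < q`, `qh ≤ ¼`), then `(Z² e^{|Z|})^q` is integrable and
`∫ (Z² e^{|Z|})^q dμ ≤ (8hq/e)^{2q} · 2e`.  (The `4q`-th moment of `Z` at `t = 1/(2h)`, the exponential
factor at `t = 2q`, split by AM–GM.) [cite: Buchholz2016, Thm 4.5 (proof)] -/
theorem integral_rpow_sq_mul_exp_abs_le {α : Type*} [MeasurableSpace α] {μ : Measure α} {Z : α → ℝ}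
    (hZm : AEStronglyMeasurable Z μ) {h q : ℝ} (hh : 0 < h) (hq : 1 < q) (hqh : q * h ≤ 1 / 4)
    (hmgf : ∀ t : ℝ, 0 ≤ t → t * h ≤ 1 / 2 →
      Integrable (fun y => Real.exp (t * Z y) + Real.exp (-(t * Z y))) μ ∧
      ∫ y, (Real.exp (t * Z y) + Real.exp (-(t * Z y))) ∂μ ≤ 2 * Real.exp 1) :
    Integrable (fun y => (Z y ^ 2 * Real.exp |Z y|) ^ q) μ ∧
      ∫ y, (Z y ^ 2 * Real.exp |Z y|) ^ q ∂μ ≤ (8 * h * q / Real.exp 1) ^ (2 * q) * (2 * Real.exp 1) := by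
  have hq0 : 0 < q := by linarith
  set t : ℝ := 1 / (2 * h) with htdef
  have ht : 0 < t := by positivity
  have hth : t * h ≤ 1 / 2 := by rw [htdef]; field_simp; norm_num
  set a : ℝ := (8 * h * q / Real.exp 1) ^ (2 * q) with hadef
  have hbase : 0 < 8 * h * q / Real.exp 1 := by positivity
  have ha : 0 < a := Real.rpow_pos_of_pos hbase _
  have ha2 : a ^ 2 = (8 * h * q / Real.exp 1) ^ (4 * q) := by
    rw [hadef, ← Real.rpow_natCast, ← Real.rpow_mul hbase.le]
    congr 1; push_cast; ring
  -- pointwise: `g^q = |Z|^{2q} e^{q|Z|} ≤ (|Z|^{4q} + a² e^{2q|Z|}) / (2a)`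
  have hgq : ∀ y, (Z y ^ 2 * Real.exp |Z y|) ^ q ≤
      (|Z y| ^ (4 * q) + a ^ 2 * Real.exp (2 * q * |Z y|)) / (2 * a) := by
    intro y
    have hgq_eq : (Z y ^ 2 * Real.exp |Z y|) ^ q = |Z y| ^ (2 * q) * Real.exp (q * |Z y|) := by
      rw [Real.mul_rpow (sq_nonneg _) (Real.exp_pos _).le, ← Real.exp_mul, mul_comm (|Z y|) q,
        ← sq_abs (Z y), ← Real.rpow_natCast, ← Real.rpow_mul (abs_nonneg _)]
      norm_num
    have hX2 : (|Z y| ^ (2 * q)) ^ 2 = |Z y| ^ (4 * q) := by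
      rw [← Real.rpow_natCast, ← Real.rpow_mul (abs_nonneg _)]
      congr 1; push_cast; ring
    have hY2 : (Real.exp (q * |Z y|)) ^ 2 = Real.exp (2 * q * |Z y|) := by
      rw [pow_two, ← Real.exp_add]; congr 1; ring
    rw [hgq_eq, le_div_iff₀ (by positivity), ← hX2, ← hY2]
    exact mul_mul_two_mul_le_sq_add_sq _ _ _
  -- the `4q`-th moment of `Z`
  have h4q : 0 < 4 * q := by positivity
  have hZpow_le : ∀ y, |Z y| ^ (4 * q) ≤
      (4 * q / (Real.exp 1 * t)) ^ (4 * q) * (Real.exp (t * Z y) + Real.exp (-(t * Z y))) :=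
    fun y => abs_rpow_le_mul_exp_add_exp ht h4q (Z y)
  have hZabs_m : AEStronglyMeasurable (fun y => |Z y|) μ := continuous_abs.comp_aestronglyMeasurable hZm
  have hZpow_int : Integrable (fun y => |Z y| ^ (4 * q)) μ := by
    refine Integrable.mono' (((hmgf t ht.le hth).1).const_mul ((4 * q / (Real.exp 1 * t)) ^ (4 * q))) ?_
      (Filter.Eventually.of_forall fun y => ?_)
    · exact (Real.continuous_rpow_const h4q.le).comp_aestronglyMeasurable hZabs_m
    · rw [Real.norm_of_nonneg (Real.rpow_nonneg (abs_nonneg _) _)]; exact hZpow_le y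
  have hZpow_bd : ∫ y, |Z y| ^ (4 * q) ∂μ ≤ (8 * h * q / Real.exp 1) ^ (4 * q) * (2 * Real.exp 1) := by
    have hconst : 4 * q / (Real.exp 1 * t) = 8 * h * q / Real.exp 1 := by
      rw [htdef]; field_simp; ring
    calc ∫ y, |Z y| ^ (4 * q) ∂μ
        ≤ ∫ y, (4 * q / (Real.exp 1 * t)) ^ (4 * q) * (Real.exp (t * Z y) + Real.exp (-(t * Z y))) ∂μ :=
          integral_mono_of_nonneg (Filter.Eventually.of_forall fun y => Real.rpow_nonneg (abs_nonneg _) _)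
            (((hmgf t ht.le hth).1).const_mul _) (Filter.Eventually.of_forall hZpow_le)
      _ = (4 * q / (Real.exp 1 * t)) ^ (4 * q) * ∫ y, (Real.exp (t * Z y) + Real.exp (-(t * Z y))) ∂μ :=
          integral_const_mul _ _
      _ ≤ (4 * q / (Real.exp 1 * t)) ^ (4 * q) * (2 * Real.exp 1) :=
          mul_le_mul_of_nonneg_left (hmgf t ht.le hth).2 (by positivity)
      _ = _ := by rw [hconst]
  -- the exponential factor
  have h2q : 0 ≤ 2 * q := by positivity
  have h2qh : 2 * q * h ≤ 1 / 2 := by linarith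
  have hexp_le : ∀ y, Real.exp (2 * q * |Z y|) ≤ Real.exp (2 * q * Z y) + Real.exp (-(2 * q * Z y)) := by
    intro y
    rcases le_or_gt 0 (Z y) with h0 | h0
    · rw [abs_of_nonneg h0]; linarith [Real.exp_pos (-(2 * q * Z y))]
    · rw [abs_of_neg h0, show 2 * q * -Z y = -(2 * q * Z y) by ring]; linarith [Real.exp_pos (2 * q * Z y)]
  have hexp_int : Integrable (fun y => Real.exp (2 * q * |Z y|)) μ := by
    refine Integrable.mono' (hmgf (2 * q) h2q h2qh).1 ?_ (Filter.Eventually.of_forall fun y => ?_)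
    · exact (Real.continuous_exp.comp (continuous_const.mul continuous_id)).comp_aestronglyMeasurable hZabs_m
    · rw [Real.norm_of_nonneg (Real.exp_pos _).le]; exact hexp_le y
  have hexp_bd : ∫ y, Real.exp (2 * q * |Z y|) ∂μ ≤ 2 * Real.exp 1 :=
    (integral_mono_of_nonneg (Filter.Eventually.of_forall fun y => (Real.exp_pos _).le)
      (hmgf (2 * q) h2q h2qh).1 (Filter.Eventually.of_forall hexp_le)).trans (hmgf (2 * q) h2q h2qh).2
  -- assemble
  set D : α → ℝ := fun y => (|Z y| ^ (4 * q) + a ^ 2 * Real.exp (2 * q * |Z y|)) / (2 * a) with hDdef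
  have hDint : Integrable D μ := (hZpow_int.add (hexp_int.const_mul _)).div_const _
  have hgm : AEStronglyMeasurable (fun y => (Z y ^ 2 * Real.exp |Z y|) ^ q) μ := by
    have hc : Continuous fun x : ℝ => (x ^ 2 * Real.exp |x|) ^ q :=
      ((continuous_pow 2).mul (Real.continuous_exp.comp continuous_abs)).rpow_const fun _ => Or.inr hq0.le
    exact hc.comp_aestronglyMeasurable hZm
  have hgint : Integrable (fun y => (Z y ^ 2 * Real.exp |Z y|) ^ q) μ :=
    Integrable.mono' hDint hgm (Filter.Eventually.of_forall fun y => by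
      rw [Real.norm_of_nonneg (Real.rpow_nonneg (by positivity) _)]; exact hgq y)
  refine ⟨hgint, ?_⟩
  calc ∫ y, (Z y ^ 2 * Real.exp |Z y|) ^ q ∂μ ≤ ∫ y, D y ∂μ :=
        integral_mono_of_nonneg (Filter.Eventually.of_forall fun y => Real.rpow_nonneg (by positivity) _)
          hDint (Filter.Eventually.of_forall hgq)
    _ = (∫ y, |Z y| ^ (4 * q) ∂μ + a ^ 2 * ∫ y, Real.exp (2 * q * |Z y|) ∂μ) / (2 * a) := by
        simp only [hDdef]
        rw [integral_div, integral_add hZpow_int (hexp_int.const_mul _), integral_const_mul]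
    _ ≤ ((8 * h * q / Real.exp 1) ^ (4 * q) * (2 * Real.exp 1) + a ^ 2 * (2 * Real.exp 1)) / (2 * a) := by
        gcongr
    _ = a * (2 * Real.exp 1) := by
        rw [← ha2]; field_simp; ring

/-! ## The degenerate case: a symmetric `B` with `tr((S B)²) ≤ 0` vanishes -/

/-- For `S ≻ 0` and symmetric `B`, `tr((S B)²) = ‖√S B √S‖²_HS`; so `tr((S B)²) ≤ 0` forces `B = 0`.
[cite: Buchholz2016, Thm 4.5 (proof)] -/
theorem eq_zero_of_trace_mul_sq_le_zero {S B : Matrix ι ι ℝ} (hS : S.PosDef) (hB : Bᵀ = B)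
    (htr : ((S * B) * (S * B)).trace ≤ 0) : B = 0 := by
  set T : Matrix ι ι ℝ := CFC.sqrt S * B * CFC.sqrt S with hTdef
  have hTh : T.IsHermitian := isHermitian_sqrt_mul_mul_sqrt S hB
  have hTt : Tᵀ = T := by
    have h := hTh.eq
    rwa [Matrix.conjTranspose_eq_transpose_of_trivial] at h
  have htrT : (Tᵀ * T).trace ≤ 0 := by
    rw [hTt, hTdef, trace_sqrt_sandwich_mul_self hS B]; exact htr
  rw [trace_transpose_mul_self_eq_sum_sq] at htrT
  have hT0 : T = 0 := by
    ext a b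
    have hab : T a b ^ 2 ≤ 0 :=
      calc T a b ^ 2 ≤ ∑ b', T a b' ^ 2 :=
            Finset.single_le_sum (f := fun b' => T a b' ^ 2) (fun _ _ => sq_nonneg _) (Finset.mem_univ b)
        _ ≤ ∑ a', ∑ b', T a' b' ^ 2 :=
            Finset.single_le_sum (f := fun a' => ∑ b', T a' b' ^ 2)
              (fun _ _ => Finset.sum_nonneg fun _ _ => sq_nonneg _) (Finset.mem_univ a)
        _ ≤ 0 := htrT
    have h0 : T a b = 0 := (pow_eq_zero_iff two_ne_zero).1 (le_antisymm hab (sq_nonneg _))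
    simpa using h0
  have hRu : IsUnit (CFC.sqrt S).det := (Matrix.isUnit_iff_isUnit_det _).1 (isUnit_sqrt hS)
  have hBT : (CFC.sqrt S)⁻¹ * T * (CFC.sqrt S)⁻¹ = B := by
    rw [hTdef, ← Matrix.mul_assoc, ← Matrix.mul_assoc, Matrix.nonsing_inv_mul _ hRu, Matrix.one_mul,
      Matrix.mul_nonsing_inv_cancel_right _ _ hRu]
  rw [← hBT, hT0, Matrix.mul_zero, Matrix.zero_mul]

/-- Two positive definite covariances with `tr((1 − S₀S₁⁻¹)²) ≤ 0` coincide.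
[cite: Buchholz2016, Thm 4.5 (proof)] -/
theorem eq_of_trace_mul_inv_sub_sq_le_zero {S₀ S₁ : Matrix ι ι ℝ} (hS₀ : S₀.PosDef) (hS₁ : S₁.PosDef)
    (htr : ((S₀ * (S₀⁻¹ - S₁⁻¹)) * (S₀ * (S₀⁻¹ - S₁⁻¹))).trace ≤ 0) : S₁ = S₀ := by
  have hBt : (S₀⁻¹ - S₁⁻¹)ᵀ = S₀⁻¹ - S₁⁻¹ := by
    rw [Matrix.transpose_sub, Matrix.transpose_nonsing_inv, Matrix.transpose_nonsing_inv,
      Literature.Probability.Distributions.transpose_eq_of_posDef hS₀,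
      Literature.Probability.Distributions.transpose_eq_of_posDef hS₁]
  have hB0 := eq_zero_of_trace_mul_sq_le_zero hS₀ hBt htr
  have hinv : S₀⁻¹ = S₁⁻¹ := sub_eq_zero.1 hB0
  have h0u : IsUnit S₀.det := hS₀.isUnit.map Matrix.detMonoidHom
  have h1u : IsUnit S₁.det := hS₁.isUnit.map Matrix.detMonoidHom
  rw [← Matrix.nonsing_inv_nonsing_inv S₁ h1u, ← hinv, Matrix.nonsing_inv_nonsing_inv S₀ h0u]

/-! ## The centred chaos in `L^q`, `k ≥ 0` allowed -/

/-- **The centred quadratic chaos in `L^q(N(0,S))`** (Whittle, [Buc16] Lemma 4.6, packaged): for `S ≻ 0`,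
`B` symmetric, `T = √S B √S` with `tr(T²) ≤ k²` (`k ≥ 0`) and `q ≥ 1`, the function
`Q(y) = yᵀBy − tr T` belongs to `L^q(N(0,S))` and `(∫ |Q|^q dN(0,S))^{1/q} ≤ 8 q k`.
[cite: Buchholz2016, Lemma 4.6] -/
theorem memLp_quadForm_sub_trace_of_trace {S : Matrix ι ι ℝ} (hS : S.PosDef) {B : Matrix ι ι ℝ}
    (hB : Bᵀ = B) {k q : ℝ} (hk : 0 ≤ k)
    (htr : ((CFC.sqrt S * B * CFC.sqrt S) * (CFC.sqrt S * B * CFC.sqrt S)).trace ≤ k ^ 2) (hq : 1 ≤ q) :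
    MemLp (fun y : EuclideanSpace ℝ ι => ofLp y ⬝ᵥ B *ᵥ ofLp y - (CFC.sqrt S * B * CFC.sqrt S).trace)
        (ENNReal.ofReal q) (multivariateGaussian 0 S) ∧
      (∫ y, |ofLp y ⬝ᵥ B *ᵥ ofLp y - (CFC.sqrt S * B * CFC.sqrt S).trace| ^ q
          ∂(multivariateGaussian 0 S)) ^ (1 / q) ≤ 8 * q * k := by
  set μ := multivariateGaussian 0 S with hμ
  set T : Matrix ι ι ℝ := CFC.sqrt S * B * CFC.sqrt S with hTdef
  set Q : EuclideanSpace ℝ ι → ℝ := fun y => ofLp y ⬝ᵥ B *ᵥ ofLp y - T.trace with hQdef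
  have hq0 : 0 < q := by linarith
  have hqE : ENNReal.ofReal q ≠ 0 := by simp [hq0]
  have hcontQ : Continuous Q := by
    have hc : Continuous fun x : EuclideanSpace ℝ ι => (ofLp x : ι → ℝ) := PiLp.continuous_ofLp 2 _
    exact (hc.dotProduct (continuous_const.matrix_mulVec hc)).sub continuous_const
  rcases hk.eq_or_lt with hk0 | hkpos
  · -- `k = 0`: `B = 0`, `Q ≡ 0`
    have hB0 : B = 0 := by
      refine eq_zero_of_trace_mul_sq_le_zero hS hB ?_
      rw [← trace_sqrt_sandwich_mul_self hS B]
      rw [← hk0] at htr; simpa using htr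
    have hQ0 : Q = fun _ => 0 := by
      funext y; simp [hQdef, hTdef, hB0]
    refine ⟨?_, ?_⟩
    · rw [hQ0]; exact memLp_const 0
    · have : (fun y => |Q y| ^ q) = fun _ => (0 : ℝ) := by
        funext y; rw [hQ0]; simp [Real.zero_rpow hq0.ne']
      rw [this, integral_const, smul_zero, Real.zero_rpow (by positivity), ← hk0, mul_zero]
  · -- `k > 0`: Whittle's moment bound and domination by the two-sided exponential moment
    have hbd : ∫ y, |Q y| ^ q ∂μ ≤ (4 * k * q / Real.exp 1) ^ q * (2 * Real.exp 1) :=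
      integral_abs_quadForm_sub_trace_rpow_le hS hB hkpos htr hq0
    set t : ℝ := 1 / (4 * k) with htdef
    have ht : 0 < t := by positivity
    have hs1 : 2 * |t| * k ≤ 1 / 2 := by
      rw [abs_of_nonneg ht.le, htdef]; field_simp; norm_num
    have hs2 : 2 * |(-t)| * k ≤ 1 / 2 := by rwa [abs_neg]
    have hint : ∀ s : ℝ, 2 * |s| * k ≤ 1 / 2 →
        Integrable (fun y : EuclideanSpace ℝ ι => Real.exp (s * Q y)) μ := by
      intro s hs'
      have := (integrable_exp_mul_quadForm (S := S) hB hk htr hs').const_mul (Real.exp (-(s * T.trace)))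
      refine this.congr (Filter.Eventually.of_forall fun y => ?_)
      simp only [hQdef]
      rw [← Real.exp_add]; congr 1; ring
    have hdom : Integrable (fun y => (q / (Real.exp 1 * t)) ^ q *
        (Real.exp (t * Q y) + Real.exp (-(t * Q y)))) μ := by
      refine ((hint t hs1).add ?_).const_mul _
      exact (hint (-t) hs2).congr (Filter.Eventually.of_forall fun y => by simp only [neg_mul])
    have hQq_int : Integrable (fun y => |Q y| ^ q) μ := by
      refine hdom.mono'
        (((continuous_abs.comp hcontQ).rpow_const fun _ => Or.inr hq0.le).aestronglyMeasurable)
        (Filter.Eventually.of_forall fun y => ?_)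
      rw [Real.norm_of_nonneg (Real.rpow_nonneg (abs_nonneg _) _)]
      exact abs_rpow_le_mul_exp_add_exp ht hq0 (Q y)
    have hmem : MemLp Q (ENNReal.ofReal q) μ := by
      rw [← integrable_norm_rpow_iff hcontQ.aestronglyMeasurable hqE ENNReal.ofReal_ne_top,
        ENNReal.toReal_ofReal hq0.le]
      exact hQq_int.congr (Filter.Eventually.of_forall fun y => by simp only [Real.norm_eq_abs])
    refine ⟨hmem, ?_⟩
    have hbase : 0 < 4 * k * q / Real.exp 1 := by positivity
    have he1 : 1 ≤ 2 * Real.exp 1 := by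
      have := Real.add_one_le_exp (1 : ℝ); linarith
    calc (∫ y, |Q y| ^ q ∂μ) ^ (1 / q) ≤ ((4 * k * q / Real.exp 1) ^ q * (2 * Real.exp 1)) ^ (1 / q) :=
          Real.rpow_le_rpow (integral_nonneg fun y => by positivity) hbd (by positivity)
      _ = (4 * k * q / Real.exp 1) * (2 * Real.exp 1) ^ (1 / q) := by
          rw [Real.mul_rpow (Real.rpow_nonneg hbase.le _) (by positivity), ← Real.rpow_mul hbase.le,
            mul_one_div_cancel hq0.ne', Real.rpow_one]
      _ ≤ (4 * k * q / Real.exp 1) * (2 * Real.exp 1) := by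
          refine mul_le_mul_of_nonneg_left ?_ hbase.le
          calc (2 * Real.exp 1) ^ (1 / q) ≤ (2 * Real.exp 1) ^ (1 : ℝ) :=
                Real.rpow_le_rpow_of_exponent_le he1 (by rw [div_le_one hq0]; exact hq)
            _ = 2 * Real.exp 1 := Real.rpow_one _
      _ = 8 * q * k := by field_simp; ring

/-! ## The representation of the density ratio -/

/-- **`dN(0,S₁)/dN(0,S₀) = exp(c + ½Q)` with `|c| ≤ h²`**: for `S₀, S₁ ≻ 0` with
`tr((1 − S₀S₁⁻¹)²) ≤ h²`, `0 ≤ h ≤ ¼`, there is a constant `c` (`= ½Σ(log(1−λᵢ) + λᵢ) ∈ [−h², 0]`, `λᵢ` the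
eigenvalues of `T = √S₀(S₀⁻¹ − S₁⁻¹)√S₀`) with
`(gaussRatio S₀ S₁ y) = exp(c + ½(yᵀ(S₀⁻¹ − S₁⁻¹)y − tr T))` for every `y`.
[cite: Buchholz2016, Thm 4.5 (proof)] -/
theorem exists_gaussRatio_eq_exp_of_trace {S₀ S₁ : Matrix ι ι ℝ} (hS₀ : S₀.PosDef) (hS₁ : S₁.PosDef)
    {h : ℝ} (hh0 : 0 ≤ h) (hh4 : h ≤ 1 / 4)
    (htr : ((S₀ * (S₀⁻¹ - S₁⁻¹)) * (S₀ * (S₀⁻¹ - S₁⁻¹))).trace ≤ h ^ 2) :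
    ∃ c : ℝ, |c| ≤ h ^ 2 ∧ ∀ y : EuclideanSpace ℝ ι, (gaussRatio S₀ S₁ y).toReal =
      Real.exp (c + (ofLp y ⬝ᵥ (S₀⁻¹ - S₁⁻¹) *ᵥ ofLp y -
        (CFC.sqrt S₀ * (S₀⁻¹ - S₁⁻¹) * CFC.sqrt S₀).trace) / 2) := by
  set μ := multivariateGaussian 0 S₀ with hμ
  set B : Matrix ι ι ℝ := S₀⁻¹ - S₁⁻¹ with hBdef
  have hBt : Bᵀ = B := by
    rw [hBdef, Matrix.transpose_sub, Matrix.transpose_nonsing_inv, Matrix.transpose_nonsing_inv,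
      Literature.Probability.Distributions.transpose_eq_of_posDef hS₀,
      Literature.Probability.Distributions.transpose_eq_of_posDef hS₁]
  set T : Matrix ι ι ℝ := CFC.sqrt S₀ * B * CFC.sqrt S₀ with hTdef
  have hT : T.IsHermitian := isHermitian_sqrt_mul_mul_sqrt S₀ hBt
  have htrT : (T * T).trace ≤ h ^ 2 := by rw [hTdef, trace_sqrt_sandwich_mul_self hS₀ B]; exact htr
  have hsqsum : ∑ i, hT.eigenvalues i ^ 2 ≤ h ^ 2 := by
    have htr2 : (T * T).trace = ∑ j, hT.eigenvalues j ^ 2 := by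
      have hsp := hT.spectral_theorem
      have hTT : T * T = conjStarAlgAut ℝ (Matrix ι ι ℝ) hT.eigenvectorUnitary
          (diagonal (RCLike.ofReal ∘ hT.eigenvalues) * diagonal (RCLike.ofReal ∘ hT.eigenvalues)) := by
        rw [map_mul, ← hsp]
      rw [hTT, conjStarAlgAut_apply, trace_mul_cycle, coe_star_mul_self, one_mul, diagonal_mul_diagonal,
        trace_diagonal]
      refine Finset.sum_congr rfl fun j _ => ?_
      simp [pow_two]
    rw [← htr2]; exact htrT
  have hμT : ∀ i, |hT.eigenvalues i| ≤ h := abs_eigenvalues_le_of_trace hT hh0 htrT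
  set u : EuclideanSpace ℝ ι → ℝ := fun y => ofLp y ⬝ᵥ B *ᵥ ofLp y with hu
  set κ : ℝ := (gaussZ S₀⁻¹ * (gaussZ S₁⁻¹)⁻¹).toReal with hκ
  have hr : ∀ y, (gaussRatio S₀ S₁ y).toReal = κ * Real.exp (u y / 2) := fun y => toReal_gaussRatio y
  have hint_r : ∫ y, κ * Real.exp (u y / 2) ∂μ = 1 := by
    have := integral_gaussRatio hS₀ hS₁
    simp_rw [hr] at this
    exact this
  -- `∫ e^{u/2} dμ = 1/√det(1 − T)`
  have hsub1 : ((1 : Matrix ι ι ℝ) - CFC.sqrt S₀ * B * CFC.sqrt S₀).PosDef := by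
    have h12 : 2 * |(1 / 2 : ℝ)| * h ≤ 1 / 2 := by
      rw [abs_of_nonneg (by norm_num : (0:ℝ) ≤ 1 / 2)]; linarith
    have := posDef_one_sub_smul_of_trace hT hh0 htrT h12
    rw [show (2 * (1 / 2 : ℝ)) = 1 by norm_num, one_smul] at this
    exact this
  have hI : ∫ y, Real.exp (u y / 2) ∂μ = 1 / Real.sqrt ((1 : Matrix ι ι ℝ) - T).det := by
    have hmain := Literature.Probability.Distributions.integral_exp_half_quadratic_multivariateGaussian
      (S := S₀) hS₀.posSemidef hBt hsub1
    rw [← Literature.Probability.Distributions.det_one_sub_sqrt_mul_sqrt (sqrt_mul_sqrt hS₀) B] at hmain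
    exact hmain
  have hdetprod : ((1 : Matrix ι ι ℝ) - T).det = ∏ i, (1 - hT.eigenvalues i) :=
    Literature.Analysis.Matrix.det_one_sub_eq_prod_one_sub_eigenvalues hT
  have hfac : ∀ i, 0 < 1 - hT.eigenvalues i := fun i => by
    have := (abs_le.1 (hμT i)).2; linarith
  have hdetpos : 0 < ((1 : Matrix ι ι ℝ) - T).det := by
    rw [hdetprod]; exact Finset.prod_pos fun i _ => hfac i
  have hspos : 0 < Real.sqrt ((1 : Matrix ι ι ℝ) - T).det := Real.sqrt_pos.2 hdetpos
  have hκeq : κ = Real.sqrt ((1 : Matrix ι ι ℝ) - T).det := by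
    have hκI : κ * ∫ y, Real.exp (u y / 2) ∂μ = 1 := by rw [← integral_const_mul]; exact hint_r
    rw [hI, mul_one_div, div_eq_one_iff_eq hspos.ne'] at hκI
    exact hκI
  have hκpos : 0 < κ := by rw [hκeq]; exact hspos
  -- `c = log κ + ½ tr T ∈ [−h², 0]`
  set c : ℝ := Real.log κ + T.trace / 2 with hcdef
  have htrT' : T.trace = ∑ i, hT.eigenvalues i := by
    have := hT.trace_eq_sum_eigenvalues; simpa using this
  have hlogκ : Real.log κ = (∑ i, Real.log (1 - hT.eigenvalues i)) / 2 := by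
    rw [hκeq, Real.log_sqrt hdetpos.le, hdetprod, Real.log_prod (fun i _ => (hfac i).ne')]
  have hc_eq : c = (∑ i, (Real.log (1 - hT.eigenvalues i) + hT.eigenvalues i)) / 2 := by
    rw [hcdef, hlogκ, htrT', Finset.sum_add_distrib]; ring
  have hc_abs : |c| ≤ h ^ 2 := by
    obtain ⟨h1, h2⟩ := half_sum_log_one_sub_add_mem hh4 hμT hsqsum
    rw [hc_eq]
    exact abs_le.2 ⟨h1, h2.trans (by positivity)⟩
  refine ⟨c, hc_abs, fun y => ?_⟩
  rw [hr y, ← Real.exp_log hκpos, ← Real.exp_add]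
  congr 1
  simp only [hcdef]; ring

end Literature.MathematicalPhysics.QuantumFieldTheory

end
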